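import Mathlib
import Literature.AlgebraicGeometry.Resolution.CobordantVertexChart
import Literature.AlgebraicGeometry.Resolution.NodalFamilyRingDomain
import Summits.ResolutionOfSingularities.ResolutionOfSingularities.Theorems.WeightedInvariantLocalWeightedDropSpaceCountDefs
import Summits.ResolutionOfSingularities.ResolutionOfSingularities.Theorems.WeightedInvariantLocalWeightedDropTupleDropAssembly

/-!
# `WeightedInvariant.LocalWeightedDrop`, line `tame-four-tuple-drop`, stub (A3) piece (A3-α): THE COUNT GAME —
# a radical count with free smooth centres from FINITE-DEPTH WINNABILITY (dimension- and predicate-generic)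

Crux item stmt-ResolutionOfSingularities-8899 `LocalWeightedDrop` (route `ResolutionOfSingularities/WeightedInvariant`); strategist line
`tame-four-tuple-drop` (res-L1-w43-strat-1), stub (A3) `stub_spaceNonNCCountRad_of_CJS` cut (arbiter's RULING 05:42:56Z) as
(A3) = (A3-β) TRANSFER ∘ (A3-α) GAME LAYER.  [OURS · L1 W4.3, chain w43, res-type-056 = (A3-α); (A3-β) = res-type-088 (the Cossart–Jannsen–Saito
tower supplies the finite depth).  Game-theoretic bookkeeping over `k⟦x⟧`; nothing here is a statement of any manuscript.]

THE GAME.  Positions: germs `b ∈ k⟦x₀,…,x_m⟧`; terminal predicate `P` (a parameter; `GermIsNC` for (A3), `order < 2` for stub-4's T4).  A MOVE is a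
legal coordinate change `Φ` with weights `w ∈ {0,1}^{m+1} ∖ 0` (`IsCountMove`); the opponent answers with an exceptional point `c ≠ 0` (`cᵢ = 0` on
the weight-`0` slots) and a factorisation `b∘Φ(chart_{w,c}) = s^A·G`, `s ∤ G`; the mover then picks a live slot `i` (`cᵢ ≠ 0`) and the new position is
`s · G|_{y′ᵢ = 0}` (one copy of the exceptional divisor times the sliced strict transform).
* `WinsIn P n b` — the mover forces `P` within `n` rounds (recursive in `n`; `winsIn_done`, `winsIn_move`, `WinsIn.mono`).  An ℕ-valued count
  needs a UNIFORM round bound over the opponent's (infinitely many) answers, so the totality input of (A3-β) is `∀ b ≠ 0, ∃ n, WinsIn P n b`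
  (for the CJS tower: `n` = its length), not an inductive winning region.
* `winsIn_of_dvd_pow` — RADICAL TRANSPORT: if `P` is radical-hereditary (`P d → b ∣ d^(N+1) → P b`, all `N`), then `WinsIn P n d → b ∣ d^(N+1) →
  WinsIn P n b` (`d ≠ 0`): play `d`'s move for `b`; at an answer `(c, A_b, G_b)` factor `d∘Φ(chart) = s^{A_d} G_d` (`subst_chart_ne_zero`,
  `exists_eq_X_pow_mul_not_dvd`); `b ∣ d^(N+1)` gives `s^{A_b} G_b ∣ s^{(N+1)A_d} G_d^{N+1}`, `s` prime and `s ∤ G_b, G_d` give `A_b ≤ (N+1)A_d` and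
  `G_b ∣ s^r G_d^{N+1}`; slices are ring maps fixing `s`, so `s·G_b| ∣ (s·G_d|)^{r+N+1}` — the exponent grows, whence heredity for ALL exponents —
  and `s·G_d| ≠ 0` (`TupleDropAssembly.slice_ne_zero`).
* `depth`, `count_of_winsIn` — with totality, `ν b :=` the least `n` (`0` at `b = 0`) satisfies (i) `ν b = 0 ↔ P b`, (ii) `b ∣ d^(N+1) → ν b ≤ ν d`,
  (iii) the depth-attaining move drops `ν` at some live slot of every answer — in EXACTLY the clause shapes of `GermNonNCCountRad` /
  `tupleDrop_of_count_of_monomialPhase` (p501911); `germNonNCCountRad_of_winsIn`, `spaceGermNonNCCountRad_of_winsIn` are the instances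
  `P := GermIsNC` (heredity of `GermIsNC` is (A3-β)'s (N1), taken as a hypothesis here).
-/

set_option linter.dupNamespace false -- mandated namespace of this single-conjunct summit

namespace Summit.ResolutionOfSingularities.ResolutionOfSingularities.Theorems

namespace TameFourTupleDrop

open MvPowerSeries Literature.AlgebraicGeometry.Resolution

variable {k : Type} [Field k] {m : ℕ}

/-! ## Moves and finite-depth winnability -/

/-- A MOVE of the count game: a legal coordinate change `Φ` (zero constant terms, invertible linear part) and weights `w ∈ {0,1}^{m+1} ∖ 0`
(a smooth centre through the point). -/
def IsCountMove (Φ : Fin (m + 1) → MvPowerSeries (Fin (m + 1)) k) (w : Fin (m + 1) → ℕ) : Prop :=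
  (∀ i, constantCoeff (Φ i) = 0) ∧ IsUnit (Matrix.det (Matrix.of fun i j => coeff (Finsupp.single j 1) (Φ i))) ∧
    (∀ i, w i ≤ 1) ∧ ∃ i, 0 < w i

/-- The MOVE CLAUSE with goodness predicate `good` on the new positions: at every exceptional point `c ≠ 0` (convention `cᵢ = 0` on the
weight-`0` slots) and every factorisation `b∘Φ(chart_{w,c}) = s^A·G`, `s ∤ G`, some live slot `i` has a good new position `s · G|_{y′ᵢ = 0}`. -/
def MoveClause (b : MvPowerSeries (Fin (m + 1)) k) (Φ : Fin (m + 1) → MvPowerSeries (Fin (m + 1)) k) (w : Fin (m + 1) → ℕ)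
    (good : MvPowerSeries (Fin (m + 1)) k → Prop) : Prop :=
  ∀ c : Fin (m + 1) → k, (∀ i, w i = 0 → c i = 0) → c ≠ 0 →
    ∀ (A : ℕ) (G : MvPowerSeries (Fin (m + 1 + 1)) k),
      subst (CobordantChart.chart w c) (subst Φ b) = X 0 ^ A * G → ¬ (X (0 : Fin (m + 1 + 1)) ∣ G) →
      ∃ i : Fin (m + 1), c i ≠ 0 ∧ good (X 0 * TupleGame.slice i G)

/-- `WinsIn P n b`: the mover forces the terminal predicate `P` from `b` within `n` rounds. -/
def WinsIn (P : MvPowerSeries (Fin (m + 1)) k → Prop) : ℕ → MvPowerSeries (Fin (m + 1)) k → Prop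
  | 0, b => P b
  | n + 1, b => WinsIn P n b ∨ ∃ (Φ : Fin (m + 1) → MvPowerSeries (Fin (m + 1)) k) (w : Fin (m + 1) → ℕ),
      IsCountMove Φ w ∧ MoveClause b Φ w (WinsIn P n)

/-- Unfolding at `0`. -/
theorem winsIn_zero (P : MvPowerSeries (Fin (m + 1)) k → Prop) (b : MvPowerSeries (Fin (m + 1)) k) : WinsIn P 0 b ↔ P b := Iff.rfl

/-- Unfolding at a successor. -/
theorem winsIn_succ (P : MvPowerSeries (Fin (m + 1)) k → Prop) (n : ℕ) (b : MvPowerSeries (Fin (m + 1)) k) :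
    WinsIn P (n + 1) b ↔ WinsIn P n b ∨ ∃ (Φ : Fin (m + 1) → MvPowerSeries (Fin (m + 1)) k) (w : Fin (m + 1) → ℕ),
      IsCountMove Φ w ∧ MoveClause b Φ w (WinsIn P n) := Iff.rfl

/-- The move clause is monotone in the goodness predicate. -/
theorem MoveClause.mono {b : MvPowerSeries (Fin (m + 1)) k} {Φ : Fin (m + 1) → MvPowerSeries (Fin (m + 1)) k} {w : Fin (m + 1) → ℕ}
    {good good' : MvPowerSeries (Fin (m + 1)) k → Prop} (hle : ∀ g, good g → good' g) (h : MoveClause b Φ w good) :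
    MoveClause b Φ w good' :=
  fun c hc hc0 A G hfac hG => by
    obtain ⟨i, hi, hgood⟩ := h c hc hc0 A G hfac hG
    exact ⟨i, hi, hle _ hgood⟩

/-- Constructor `done`: a terminal position is won in any number of rounds. -/
theorem winsIn_done {P : MvPowerSeries (Fin (m + 1)) k → Prop} {b : MvPowerSeries (Fin (m + 1)) k} (hb : P b) : ∀ n, WinsIn P n b
  | 0 => hb
  | n + 1 => Or.inl (winsIn_done hb n)

/-- `WinsIn` is monotone in the number of rounds. -/
theorem WinsIn.mono {P : MvPowerSeries (Fin (m + 1)) k → Prop} {n n' : ℕ} (hle : n ≤ n') {b : MvPowerSeries (Fin (m + 1)) k}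
    (h : WinsIn P n b) : WinsIn P n' b := by
  induction hle with
  | refl => exact h
  | step _ ih => exact Or.inl ih

/-- Constructor `move`: a move all of whose answers have a live slot won within `n` rounds wins within `n + 1`. -/
theorem winsIn_move {P : MvPowerSeries (Fin (m + 1)) k → Prop} {n : ℕ} {b : MvPowerSeries (Fin (m + 1)) k}
    {Φ : Fin (m + 1) → MvPowerSeries (Fin (m + 1)) k} {w : Fin (m + 1) → ℕ} (hmv : IsCountMove Φ w)
    (h : MoveClause b Φ w (WinsIn P n)) : WinsIn P (n + 1) b :=
  Or.inr ⟨Φ, w, hmv, h⟩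

/-! ## Small algebra: slices, `s`-saturations, divisibility -/

/-- The slice is multiplicative. -/
theorem slice_mul (i : Fin (m + 1)) (F G : MvPowerSeries (Fin (m + 1 + 1)) k) :
    TupleGame.slice i (F * G) = TupleGame.slice i F * TupleGame.slice i G := by
  unfold TupleGame.slice
  rw [← coe_substAlgHom (CobordantChartPlaneSlice.hasSubst_slice (R := k) i), map_mul]

/-- The slice of a power. -/
theorem slice_pow (i : Fin (m + 1)) (F : MvPowerSeries (Fin (m + 1 + 1)) k) (n : ℕ) :
    TupleGame.slice i (F ^ n) = TupleGame.slice i F ^ n := by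
  unfold TupleGame.slice
  rw [← coe_substAlgHom (CobordantChartPlaneSlice.hasSubst_slice (R := k) i), map_pow]

/-- COMPARISON OF `s`-SATURATIONS: if `s^{A} G ∣ s^{M} H` with `s ∤ H`, then `A ≤ M` and `G ∣ s^{M − A} H`. -/
theorem dvd_of_X_pow_mul_dvd {A M : ℕ} {G H : MvPowerSeries (Fin (m + 1 + 1)) k} (hH : ¬ X 0 ∣ H)
    (h : X 0 ^ A * G ∣ X 0 ^ M * H) : A ≤ M ∧ G ∣ X 0 ^ (M - A) * H := by
  have hprime := MvPowerSeries.prime_X' k (0 : Fin (m + 1 + 1))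
  obtain ⟨q, hq⟩ := h
  have hle : A ≤ M := by
    by_contra hlt
    push Not at hlt
    apply hH
    -- cancel `s^M`: `s^(A - M) G q = H`, so `s ∣ H`
    have hcancel : H = X 0 ^ (A - M) * G * q := by
      have h1 : X 0 ^ M * H = X 0 ^ M * (X 0 ^ (A - M) * G * q) := by
        rw [hq, ← mul_assoc, ← mul_assoc, ← pow_add, Nat.add_sub_cancel' hlt.le]
      exact mul_left_cancel₀ (pow_ne_zero M hprime.ne_zero) h1
    rw [hcancel, mul_assoc]
    exact dvd_mul_of_dvd_left (dvd_pow_self _ (by omega)) _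
  refine ⟨hle, ⟨q, ?_⟩⟩
  have h1 : X 0 ^ A * (X 0 ^ (M - A) * H) = X 0 ^ A * (G * q) := by
    rw [← mul_assoc, ← pow_add, Nat.add_sub_cancel' hle, hq, mul_assoc]
  exact mul_left_cancel₀ (pow_ne_zero A hprime.ne_zero) h1

/-- `s ∤ Hⁿ⁺¹` when `s ∤ H`. -/
theorem not_X_dvd_pow {H : MvPowerSeries (Fin (m + 1 + 1)) k} (hH : ¬ X 0 ∣ H) (n : ℕ) : ¬ X 0 ∣ H ^ n := fun h =>
  hH ((MvPowerSeries.prime_X' k (0 : Fin (m + 1 + 1))).dvd_of_dvd_pow h)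

/-! ## Radical transport -/

/-- RADICAL TRANSPORT OF WINNABILITY (OURS · L1 W4.3, piece (A3-α)).  If the terminal predicate is radical-hereditary — `P d`, `b ∣ d^(N+1)`,
`d ≠ 0` imply `P b`, for every exponent — then so is `WinsIn P n`: play `d`'s move for `b`. -/
theorem winsIn_of_dvd_pow {P : MvPowerSeries (Fin (m + 1)) k → Prop}
    (hP : ∀ (N : ℕ) (b d : MvPowerSeries (Fin (m + 1)) k), d ≠ 0 → P d → b ∣ d ^ (N + 1) → P b) :
    ∀ (n N : ℕ) (b d : MvPowerSeries (Fin (m + 1)) k), d ≠ 0 → WinsIn P n d → b ∣ d ^ (N + 1) → WinsIn P n b := by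
  intro n
  induction n with
  | zero => exact fun N b d hd hPd hbd => hP N b d hd hPd hbd
  | succ n ih =>
    intro N b d hd hwin hbd
    rcases hwin with hwin | ⟨Φ, w, hmv, hclause⟩
    · exact Or.inl (ih N b d hd hwin hbd)
    refine Or.inr ⟨Φ, w, hmv, ?_⟩
    intro c hc hc0 Ab Gb hfacb hGb
    obtain ⟨hΦ0, hdet, hw1, -⟩ := hmv
    have hΦs : HasSubst Φ := hasSubst_of_constantCoeff_zero hΦ0
    have hch := CobordantChart.hasSubst_chart w c hc
    -- `d`'s transform and its `s`-saturation
    have hD : subst (CobordantChart.chart w c) (subst Φ d) ≠ 0 :=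
      CobordantChart.subst_chart_ne_zero w c hc (FormalCoordChange.subst_ne_zero_of_isUnit_det hΦ0 hdet hd)
    obtain ⟨Ad, Gd, hfacd, hGd⟩ := CobordantVertexChart.exists_eq_X_pow_mul_not_dvd hD
    obtain ⟨i, hci, hwini⟩ := hclause c hc hc0 Ad Gd hfacd hGd
    refine ⟨i, hci, ?_⟩
    -- `b ∣ d^(N+1)` transported through `Φ`, the chart and the saturations
    obtain ⟨q, hq⟩ := hbd
    have hdiv : X 0 ^ Ab * Gb ∣ X 0 ^ (Ad * (N + 1)) * Gd ^ (N + 1) := by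
      have hTd : (subst (CobordantChart.chart w c) (subst Φ d)) ^ (N + 1) =
          subst (CobordantChart.chart w c) (subst Φ b) * subst (CobordantChart.chart w c) (subst Φ q) := by
        rw [← coe_substAlgHom hΦs, ← coe_substAlgHom hch, ← map_pow, ← map_pow, hq, map_mul, map_mul]
      refine ⟨subst (CobordantChart.chart w c) (subst Φ q), ?_⟩
      rw [← hfacb, ← hTd, hfacd, mul_pow, ← pow_mul]
    obtain ⟨-, hGdiv⟩ := dvd_of_X_pow_mul_dvd (not_X_dvd_pow hGd (N + 1)) hdiv
    set r := Ad * (N + 1) - Ab with hr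
    -- the sliced positions: `s · Gb| ∣ (s · Gd|)^(r + N + 1)`
    have hslice : X 0 * TupleGame.slice i Gb ∣ (X 0 * TupleGame.slice i Gd) ^ (r + N + 1) := by
      obtain ⟨u, hu⟩ := hGdiv
      refine ⟨X 0 ^ N * TupleGame.slice i Gd ^ r * TupleGame.slice i u, ?_⟩
      have hs := congrArg (TupleGame.slice i) hu
      rw [MultiplicityLift.slice_X_zero_pow_mul, slice_mul, slice_pow] at hs
      calc (X 0 * TupleGame.slice i Gd) ^ (r + N + 1)
          = X 0 ^ (N + 1) * TupleGame.slice i Gd ^ r * (X 0 ^ r * TupleGame.slice i Gd ^ (N + 1)) := by ring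
        _ = X 0 ^ (N + 1) * TupleGame.slice i Gd ^ r * (TupleGame.slice i Gb * TupleGame.slice i u) := by rw [hs]
        _ = X 0 * TupleGame.slice i Gb * (X 0 ^ N * TupleGame.slice i Gd ^ r * TupleGame.slice i u) := by ring
    have hne : X 0 * TupleGame.slice i Gd ≠ 0 :=
      mul_ne_zero (MvPowerSeries.prime_X' k (0 : Fin (m + 1))).ne_zero
        (TupleDropAssembly.slice_ne_zero (subst Φ d) w c hc hw1 Ad Gd hfacd hGd i hci)
    exact ih (r + N) _ _ hne hwini hslice

/-! ## The count -/

section Count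

variable (P : MvPowerSeries (Fin (m + 1)) k → Prop) (htot : ∀ b : MvPowerSeries (Fin (m + 1)) k, b ≠ 0 → ∃ n, WinsIn P n b)

open Classical in
/-- THE DEPTH: the least number of rounds in which the mover forces `P` (and `0` at the zero germ). -/
noncomputable def depth (b : MvPowerSeries (Fin (m + 1)) k) : ℕ :=
  if h : b = 0 then 0 else Nat.find (htot b h)

/-- The depth is attained. -/
theorem winsIn_depth {b : MvPowerSeries (Fin (m + 1)) k} (hb : b ≠ 0) : WinsIn P (depth P htot b) b := by
  classical
  unfold depth
  rw [dif_neg hb]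
  exact Nat.find_spec (htot b hb)

/-- The depth is minimal. -/
theorem depth_le {b : MvPowerSeries (Fin (m + 1)) k} {n : ℕ} (h : WinsIn P n b) : depth P htot b ≤ n := by
  classical
  unfold depth
  split_ifs with hb
  · exact Nat.zero_le _
  · exact Nat.find_min' (htot b hb) h

/-- Clause (i): `depth b = 0 ↔ P b` for `b ≠ 0`. -/
theorem depth_eq_zero_iff {b : MvPowerSeries (Fin (m + 1)) k} (hb : b ≠ 0) : depth P htot b = 0 ↔ P b := by
  classical
  constructor
  · intro h
    have hw := winsIn_depth P htot hb
    rw [h] at hw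
    exact hw
  · intro hPb
    exact Nat.le_zero.mp (depth_le P htot (winsIn_done hPb 0))

/-- Clause (iii): from a non-zero non-terminal position the depth-attaining move drops the depth at some live slot of every answer. -/
theorem exists_move_depth_lt {b : MvPowerSeries (Fin (m + 1)) k} (hb : b ≠ 0) (hPb : ¬ P b) :
    ∃ (Φ : Fin (m + 1) → MvPowerSeries (Fin (m + 1)) k) (w : Fin (m + 1) → ℕ),
      IsCountMove Φ w ∧ MoveClause b Φ w (fun g => depth P htot g < depth P htot b) := by
  classical
  obtain ⟨n, hn⟩ : ∃ n, depth P htot b = n + 1 := by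
    have h0 : depth P htot b ≠ 0 := fun h => hPb ((depth_eq_zero_iff P htot hb).mp h)
    exact ⟨depth P htot b - 1, by omega⟩
  have hw := winsIn_depth P htot hb
  rw [hn] at hw
  rcases hw with hw | ⟨Φ, w, hmv, hclause⟩
  · exact absurd (depth_le P htot hw) (by omega)
  · refine ⟨Φ, w, hmv, hclause.mono fun g hg => ?_⟩
    rw [hn]
    exact Nat.lt_succ_of_le (depth_le P htot hg)

/-- Clause (ii), given radical heredity of `P`: `b ∣ d^(N+1)`, `d ≠ 0` ⇒ `depth b ≤ depth d`. -/
theorem depth_le_of_dvd_pow (hP : ∀ (N : ℕ) (b d : MvPowerSeries (Fin (m + 1)) k), d ≠ 0 → P d → b ∣ d ^ (N + 1) → P b)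
    {b d : MvPowerSeries (Fin (m + 1)) k} (hd : d ≠ 0) {N : ℕ} (hbd : b ∣ d ^ (N + 1)) : depth P htot b ≤ depth P htot d :=
  depth_le P htot (winsIn_of_dvd_pow hP _ N b d hd (winsIn_depth P htot hd) hbd)

include htot in
/-- THE COUNT FROM FINITE-DEPTH WINNABILITY (OURS · L1 W4.3, piece (A3-α); dimension- and predicate-generic): if every non-zero germ is won
in finitely many rounds and `P` is radical-hereditary, then the depth is a count with (i)/(ii)/(iii) in the clause shapes of `GermNonNCCountRad` /
`tupleDrop_of_count_of_monomialPhase`. -/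
theorem count_of_winsIn (hP : ∀ (N : ℕ) (b d : MvPowerSeries (Fin (m + 1)) k), d ≠ 0 → P d → b ∣ d ^ (N + 1) → P b) :
    ∃ ν : MvPowerSeries (Fin (m + 1)) k → ℕ,
      (∀ b : MvPowerSeries (Fin (m + 1)) k, b ≠ 0 → (ν b = 0 ↔ P b)) ∧
      (∀ b d : MvPowerSeries (Fin (m + 1)) k, d ≠ 0 → ∀ N : ℕ, b ∣ d ^ (N + 1) → ν b ≤ ν d) ∧
      (∀ b : MvPowerSeries (Fin (m + 1)) k, b ≠ 0 → ¬ P b →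
        ∃ (Φ : Fin (m + 1) → MvPowerSeries (Fin (m + 1)) k) (w : Fin (m + 1) → ℕ),
          (∀ i, MvPowerSeries.constantCoeff (Φ i) = 0) ∧
          IsUnit (Matrix.det (Matrix.of fun i j => MvPowerSeries.coeff (Finsupp.single j 1) (Φ i))) ∧
          (∀ i, w i ≤ 1) ∧ (∃ i, 0 < w i) ∧
          ∀ c : Fin (m + 1) → k, (∀ i, w i = 0 → c i = 0) → c ≠ 0 →
            ∀ (A : ℕ) (G : MvPowerSeries (Fin (m + 1 + 1)) k),
              MvPowerSeries.subst (CobordantChart.chart w c) (MvPowerSeries.subst Φ b) = MvPowerSeries.X 0 ^ A * G →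
              ¬ (MvPowerSeries.X (0 : Fin (m + 1 + 1)) ∣ G) →
              ∃ i : Fin (m + 1), c i ≠ 0 ∧ ν (MvPowerSeries.X 0 * TupleGame.slice i G) < ν b) := by
  refine ⟨depth P htot, fun b hb => depth_eq_zero_iff P htot hb, fun b d hd N hbd => depth_le_of_dvd_pow P htot hP hd hbd,
    fun b hb hPb => ?_⟩
  obtain ⟨Φ, w, ⟨hΦ0, hdet, hw1, hwpos⟩, hclause⟩ := exists_move_depth_lt P htot hb hPb
  exact ⟨Φ, w, hΦ0, hdet, hw1, hwpos, hclause⟩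

end Count

/-! ## The instances `P := GermIsNC` -/

/-- (A3) FROM (A3-β)'S INPUTS (OURS · L1 W4.3): if normal-crossing support is radical-hereditary (N1) and every non-zero germ in `m + 1` variables is
won in finitely many rounds of the count game for `GermIsNC` (the transfer from the Cossart–Jannsen–Saito tower, (A3-β)), then
`GermNonNCCountRad k m`. -/
theorem germNonNCCountRad_of_winsIn (m : ℕ)
    (hN1 : ∀ (N : ℕ) (b d : MvPowerSeries (Fin (m + 1)) k), d ≠ 0 → GermIsNC d → b ∣ d ^ (N + 1) → GermIsNC b)
    (htot : ∀ b : MvPowerSeries (Fin (m + 1)) k, b ≠ 0 → ∃ n, WinsIn GermIsNC n b) : GermNonNCCountRad k m :=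
  count_of_winsIn GermIsNC htot hN1

/-- The three-variable instance: `SpaceGermNonNCCountRad k` from (N1) and finite-depth winnability for `SpaceIsNC`. -/
theorem spaceGermNonNCCountRad_of_winsIn
    (hN1 : ∀ (N : ℕ) (b d : MvPowerSeries (Fin 3) k), d ≠ 0 → SpaceIsNC d → b ∣ d ^ (N + 1) → SpaceIsNC b)
    (htot : ∀ b : MvPowerSeries (Fin 3) k, b ≠ 0 → ∃ n, WinsIn SpaceIsNC n b) : SpaceGermNonNCCountRad k :=
  count_of_winsIn (m := 2) SpaceIsNC htot hN1

end TameFourTupleDrop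

end Summit.ResolutionOfSingularities.ResolutionOfSingularities.Theorems
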